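import Mathlib
import Summits.Ventures.PercRepro2.MeasureBridge

/-!
# Finite edge sets inside an arbitrary graph: the cell's law is the finite-dimensional marginal
of Mathlib's set-Bernoulli measure (blind cell PercRepro2, typer-1 g15, 2026-08-26)

Mathlib's `setBer(Set.univ, q)` is the product of `q`-Bernoulli laws on an ARBITRARY (possibly
infinite) edge type `ι` — the object `setBer(E(G), p)` of the programme's starting statement, with
`E(G)` the edge set of `ℤ³`.  For a finite edge set `u : Finset ι` and an event `S` of the
configurations on `u` (`Config u = u → Bool`), `cylSet u S` is the event «the open edges inside
`u` form a configuration in `S`».  The theorem of this file: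

* `setBernoulli_univ_cylSet : setBer(Set.univ, q) (cylSet u S) = ENNReal.ofReal (prob (fun _ => q) S)`
  (and `setBernoulli_univ_real_cylSet` for `Measure.real`) — every probability the cell computes as a
  finite sum on a finite graph is the probability, under Mathlib's infinite-volume product measure,
  of the corresponding cylinder event.  So the cell's finite-graph theorems are statements about
  the finite-dimensional marginals of `setBer(E(G), p)` for every graph `G`, infinite ones included.

Route: `setBernoulli_apply'` (the measure is the image of `infinitePi` on `ι → Prop` under `setOf`),
the preimage of `cylSet u S` is a Mathlib `cylinder` over `u`, `infinitePi_cylinder` reduces it to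
`Measure.pi` on `u → Prop`, and `Measure.pi` on `u → Prop` is the image of `percMeasure` on
`u → Bool` under the coordinatewise `Prop ≃ Bool` (`pi_propLaw_eq_map`, singleton by singleton).
Own work; standard axioms.
-/

namespace Summit.Ventures.PercRepro2

namespace MeasureBridge

open MeasureTheory ProbabilityTheory unitInterval
open scoped ENNReal

variable {ι : Type*}

/-- The one-edge law on `Prop` inside Mathlib's `setBernoulli` (for an edge of the set):
`True` with probability `q`, `False` with probability `1 - q`. -/
noncomputable def propLaw (q : I) : Measure Prop :=
  toNNReal q • Measure.dirac True + toNNReal (σ q) • Measure.dirac False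

/-- `propLaw q` is a probability measure. -/
instance (q : I) : IsProbabilityMeasure (propLaw q) := by
  unfold propLaw
  constructor
  simp

/-- The law inside `setBernoulli` on the full set is `propLaw` at every edge. -/
lemma setBernoulli_law_univ (q : I) (i : ι) :
    (toNNReal q • Measure.dirac (i ∈ (Set.univ : Set ι)) + toNNReal (σ q) • Measure.dirac False)
      = propLaw q := by
  simp [propLaw]

open scoped Classical in
/-- The singleton masses of `propLaw` are those of the cell's `edgeLaw` under `decide`. -/
lemma propLaw_singleton (q : I) (P : Prop) :
    propLaw q ({P} : Set Prop) = edgeLaw q {decide P} := by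
  by_cases hP : P
  · have h1 : P = True := eq_true hP
    subst h1
    rw [edgeLaw, bernoulliMeasure_apply_of_mem_of_notMem q (measurableSet_singleton _)
      (by simp) (by simp)]
    simp [propLaw, Measure.add_apply, Measure.smul_apply]
  · have h1 : P = False := eq_false hP
    subst h1
    rw [edgeLaw, bernoulliMeasure_apply_of_notMem_of_mem q (measurableSet_singleton _)
      (by simp) (by simp)]
    simp [propLaw, Measure.add_apply, Measure.smul_apply]

section Finite

variable {u : Type*} [Fintype u]

open scoped Classical in
/-- Coordinatewise `Prop ≃ Bool`: a `Prop`-valued configuration as a `Bool`-valued one. -/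
noncomputable def decideEquiv : (u → Prop) ≃ Config u :=
  Equiv.piCongrRight fun _ => Equiv.propEquivBool

omit [Fintype u] in
open scoped Classical in
/-- `decideEquiv` acts by `decide` at every coordinate. -/
lemma decideEquiv_apply (y : u → Prop) : decideEquiv y = fun e => decide (y e) := rfl

omit [Fintype u] in
/-- `decideEquiv.symm` acts by `· = true` at every coordinate. -/
lemma decideEquiv_symm_apply (ω : Config u) : decideEquiv.symm ω = fun e => ω e = true := rfl

/-- `decideEquiv.symm` is measurable. -/
lemma measurable_decideEquiv_symm : Measurable (decideEquiv.symm : Config u → (u → Prop)) :=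
  measurable_of_countable _

open scoped Classical in
/-- **`Measure.pi` of the `Prop`-laws is the image of `percMeasure`** under `decideEquiv.symm`. -/
theorem pi_propLaw_eq_map (q : I) :
    Measure.pi (fun _ : u => propLaw q) = (percMeasure fun _ => q).map decideEquiv.symm := by
  refine Measure.ext_of_singleton fun y => ?_
  have hpre : (decideEquiv.symm : Config u → (u → Prop)) ⁻¹' {y} = {decideEquiv y} := by
    ext ω
    simp only [Set.mem_preimage, Set.mem_singleton_iff]
    constructor
    · rintro rfl; exact ((decideEquiv (u := u)).apply_symm_apply ω).symm
    · rintro rfl; exact (decideEquiv (u := u)).symm_apply_apply y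
  rw [Measure.map_apply measurable_decideEquiv_symm (measurableSet_singleton y), hpre,
    percMeasure, Measure.pi_singleton, Measure.pi_singleton]
  exact Finset.prod_congr rfl fun e _ => by rw [decideEquiv_apply, propLaw_singleton]

end Finite

open scoped Classical in
/-- The configuration on the edges of `u` read off a set of open edges. -/
noncomputable def restrictSet (u : Finset ι) (s : Set ι) : Config u := fun e => decide ((e : ι) ∈ s)

/-- The cylinder event of `Set ι`: «the configuration on `u` lies in `S`». -/
noncomputable def cylSet (u : Finset ι) (S : Set (Config u)) : Set (Set ι) := restrictSet u ⁻¹' S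

/-- Membership in `cylSet`. -/
@[simp] lemma mem_cylSet {u : Finset ι} {S : Set (Config u)} {s : Set ι} :
    s ∈ cylSet u S ↔ restrictSet u s ∈ S := Iff.rfl

open scoped Classical in
/-- The preimage of `cylSet u S` under `setOf` is a Mathlib `cylinder` over `u`. -/
lemma setOf_preimage_cylSet (u : Finset ι) (S : Set (Config u)) :
    (fun P : ι → Prop => {i | P i}) ⁻¹' cylSet u S =
      MeasureTheory.cylinder u ((decideEquiv : (u → Prop) ≃ Config u) ⁻¹' S) := by
  ext P
  exact Iff.rfl

variable [DecidableEq ι]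

/-- **Finite-dimensional marginals**: for a finite edge set `u` of an arbitrary edge type `ι`,
Mathlib's `setBer(Set.univ, q)` gives the cylinder event `cylSet u S` the cell's probability
`prob (fun _ => q) S`. -/
theorem setBernoulli_univ_cylSet (q : I) (u : Finset ι) (S : Set (Config u)) :
    setBer((Set.univ : Set ι), q) (cylSet u S) = ENNReal.ofReal (prob (fun _ => (q : ℝ)) S) := by
  classical
  rw [setBernoulli_apply', setOf_preimage_cylSet]
  simp_rw [setBernoulli_law_univ]
  rw [Measure.infinitePi_cylinder (fun _ => propLaw q) MeasurableSet.of_discrete, pi_propLaw_eq_map,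
    Measure.map_apply measurable_decideEquiv_symm MeasurableSet.of_discrete,
    Equiv.symm_preimage_preimage, percMeasure_apply]

/-- `Measure.real` form of `setBernoulli_univ_cylSet`. -/
theorem setBernoulli_univ_real_cylSet (q : I) (u : Finset ι) (S : Set (Config u)) :
    setBer((Set.univ : Set ι), q).real (cylSet u S) = prob (fun _ => (q : ℝ)) S := by
  rw [measureReal_def, setBernoulli_univ_cylSet, ENNReal.toReal_ofReal]
  rw [← percMeasure_real_apply]
  exact measureReal_nonneg

end MeasureBridge

end Summit.Ventures.PercRepro2
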